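import Mathlib
import Summits.Ventures.HodgeRepro.Tier4.Target
import Summits.Ventures.HodgeRepro.Tier4.Line3.KMDatum
import Summits.Ventures.HodgeRepro.Tier4.Line3.KMDatumS
import Summits.Ventures.HodgeRepro.Tier4.Line3.Defs
import Summits.Ventures.HodgeRepro.Tier4.Line3.DefsLemmas
import Summits.Ventures.HodgeRepro.Tier4.Line3.LocalizerSet

/-!
# Tier4/Line3/LocalizerSetOff — the assembly with a main set, the majorant quantified OFF THE SET
(t4-x2 g2; crit-1 S13457 «INTERFACE MISMATCH» on `LocalizerSet` p679047)

Blind re-derivation cell `pub-hodge-repro`, Tier 4 «PROVE THE STEP» (README §9–§10), LINE L3, seat t4-x2 (reserve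
wall-breaker, g2).  Companion of `Tier4/Line3/LocalizerSet.lean` (p679047): Mathlib-level, Defs-level, `mainSet` abstract.

`LocalizerSum` / `LocalizerSet` require the majorant `bound` to dominate every term off ONE orbit (`o ≠ main`), while the
off-set mass chain (`term_dominated_of_offSetMass`, t4-L2-p3 g3, OffSetMass p679096) supplies a majorant only OFF THE SET
(`o ∉ mainSet`) — and the on-set orbits other than `main` do not decay at all (S13421 (3): their coefficients are
`∏_j κ_j(β_j) · coefQ(xm) ≠ 0` at every depth).  The proofs of p679047 use `norm_term_le` only off the set, so the honest
interface is the weaker field `norm_term_le : ∀ N o, o ∉ mainSet → ‖term (level N) (loc N) o‖ ≤ bound o`: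
`LocalizerSumOff` / `LocalizerSetOff` below, with the same conclusions `LocalizerSumOff.P` / `LocalizerSetOff.P` (the
summability of the main part comes from the expansion's own `summable_norm`, never from `bound`), and the forgetful maps
`LocalizerSum.toOff` / `LocalizerSet.toOff` (`o ∉ mainSet → o ≠ main`).  These are the shapes the (R4) instance should
build.  Nothing here asserts anything about the truth of (P); HC_CM is NOT proved by anyone in this repository.
-/

set_option autoImplicit false

noncomputable section

namespace Summit.Ventures.HodgeRepro.Tier4.Line3

open Filter Topology

open scoped Classical

section Assembly

variable {Level : Type} {Tr : Level → Type}

namespace OrbitExpansion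

variable {Orbit : Type} {pairing : ∀ K : Level, Tr K → ℂ} {term : ∀ K : Level, Tr K → Orbit → ℂ}

/-! ## APPENDIX (append-only, t4-x2 g2, crit-1 S13457 «INTERFACE MISMATCH»): the majorant quantified OFF THE SET

The structures above require the majorant `bound` to dominate every term off ONE orbit (`o ≠ main`), while the off-set
mass chain (`term_dominated_of_offSetMass`, t4-L2-p3 g3, OffSetMass p679096) supplies a majorant only OFF THE SET
(`o ∉ mainSet`) — and the on-set orbits other than `main` do not decay at all (S13421 (3): their coefficients are
`∏_j κ_j(β_j) · coefQ(xm) ≠ 0` at every depth).  The proofs above use `norm_term_le` only off the set, so the honest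
interface is the weaker field `norm_term_le : ∀ N o, o ∉ mainSet → ‖term (level N) (loc N) o‖ ≤ bound o`:
`LocalizerSumOff` / `LocalizerSetOff` below, with the same conclusions `LocalizerSumOff.P` / `LocalizerSetOff.P`
(the summability of the main part comes from the expansion's own `summable_norm`, never from `bound`), and the
forgetful maps `LocalizerSum.toOff` / `LocalizerSet.toOff` (the stronger field implies the weaker one since
`o ∉ mainSet → o ≠ main`). -/

/-- **LOCALISER WITH A MAIN SET, SUM FORM, MAJORANT OFF THE SET**: as `LocalizerSum`, with the majorant required only
for the orbits OFF `mainSet`. -/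
structure LocalizerSumOff (E : OrbitExpansion Orbit pairing term) where
  /-- the persistent orbits -/
  mainSet : Set Orbit
  /-- the level of the depth-`N` localiser -/
  level : ℕ → Level
  /-- the depth-`N` localising translate, of level `level N` -/
  loc : ∀ N : ℕ, Tr (level N)
  /-- off the main set the localiser's terms tend to `0` -/
  tendsto_zero : ∀ o : Orbit, o ∉ mainSet → Tendsto (fun N => term (level N) (loc N) o) atTop (𝓝 0)
  /-- the real part of the sum over the main set is eventually bounded below -/
  main_sum_lower : ∃ m : ℝ, 0 < m ∧ ∀ᶠ N in atTop,
    m ≤ (∑' o : Orbit, if o ∈ mainSet then term (level N) (loc N) o else 0).re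
  /-- one summable majorant of the terms OFF the main set, for all depths -/
  bound : Orbit → ℝ
  bound_nonneg : ∀ o, 0 ≤ bound o
  bound_summable : Summable bound
  norm_term_le : ∀ (N : ℕ) (o : Orbit), o ∉ mainSet → ‖term (level N) (loc N) o‖ ≤ bound o

namespace LocalizerSumOff

variable {E : OrbitExpansion Orbit pairing term} (L : E.LocalizerSumOff)

/-- The part of the expansion over the main set. -/
def mainPart (N : ℕ) : ℂ := ∑' o : Orbit, if o ∈ L.mainSet then term (L.level N) (L.loc N) o else 0

/-- The part of the expansion off the main set. -/
def offPart (N : ℕ) : ℂ := ∑' o : Orbit, if o ∈ L.mainSet then 0 else term (L.level N) (L.loc N) o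

/-- The summand over the main set is summable (a restriction of the expansion's summand). -/
theorem summable_mainPart (N : ℕ) :
    Summable (fun o : Orbit => if o ∈ L.mainSet then term (L.level N) (L.loc N) o else 0) := by
  refine Summable.of_norm_bounded (E.summable_norm (L.level N) (L.loc N)) ?_
  intro o
  by_cases ho : o ∈ L.mainSet
  · simp [ho]
  · simp [ho]

/-- The summand off the main set is summable. -/
theorem summable_offPart (N : ℕ) :
    Summable (fun o : Orbit => if o ∈ L.mainSet then 0 else term (L.level N) (L.loc N) o) := by
  refine Summable.of_norm_bounded (E.summable_norm (L.level N) (L.loc N)) ?_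
  intro o
  by_cases ho : o ∈ L.mainSet
  · simp [ho]
  · simp [ho]

/-- The pairing at depth `N` is the main part plus the off part. -/
theorem pairing_eq (N : ℕ) : pairing (L.level N) (L.loc N) = L.mainPart N + L.offPart N := by
  rw [E.expansion (L.level N) (L.loc N), mainPart, offPart, ← (L.summable_mainPart N).tsum_add (L.summable_offPart N)]
  refine tsum_congr fun o => ?_
  by_cases ho : o ∈ L.mainSet
  · simp [ho]
  · simp [ho]

/-- The off part tends to `0` (dominated convergence on the majorant off the set). -/
theorem offPart_tendsto : Tendsto L.offPart atTop (𝓝 0) := by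
  have h : Tendsto (fun N => ∑' o : Orbit, if o ∈ L.mainSet then (0 : ℂ) else term (L.level N) (L.loc N) o) atTop
      (𝓝 (∑' o : Orbit, (0 : ℂ))) := by
    refine tendsto_tsum_of_dominated_convergence L.bound_summable (fun o => ?_)
      (Eventually.of_forall fun N o => ?_)
    · by_cases ho : o ∈ L.mainSet
      · simp [ho]
      · simp only [ho, if_false]
        exact L.tendsto_zero o ho
    · by_cases ho : o ∈ L.mainSet
      · simp only [ho, if_true, norm_zero]
        exact L.bound_nonneg o
      · simp only [ho, if_false]
        exact L.norm_term_le N o ho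
  rw [tsum_zero] at h
  exact h

/-- **THE CONCLUSION OF THE ASSEMBLY, SUM FORM, MAJORANT OFF THE SET.** -/
theorem P (L : E.LocalizerSumOff) : ∃ (K : Level) (γ : Tr K), pairing K γ ≠ 0 := by
  obtain ⟨m, hm, hev⟩ := L.main_sum_lower
  have hoff : ∀ᶠ N in atTop, ‖L.offPart N‖ < m := by
    have := (L.offPart_tendsto).norm
    simp only [norm_zero] at this
    exact this.eventually (gt_mem_nhds hm)
  obtain ⟨N, hN1, hN2⟩ := (hev.and hoff).exists
  refine ⟨L.level N, L.loc N, fun h0 => ?_⟩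
  have h := L.pairing_eq N
  rw [h0] at h
  have hre : (L.mainPart N).re + (L.offPart N).re = 0 := by
    have := congrArg Complex.re h
    simpa [Complex.add_re] using this.symm
  have hre_off : -(L.offPart N).re ≤ ‖L.offPart N‖ := by
    have := Complex.abs_re_le_norm (L.offPart N)
    exact (neg_le_abs _).trans this
  have hmain : m ≤ (L.mainPart N).re := hN1
  linarith

end LocalizerSumOff

/-- A localiser in sum form with the majorant off `main` is one with the majorant off the set. -/
def LocalizerSum.toOff {E : OrbitExpansion Orbit pairing term} (L : E.LocalizerSum) : E.LocalizerSumOff :=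
  { mainSet := L.mainSet
    level := L.level
    loc := L.loc
    tendsto_zero := L.tendsto_zero
    main_sum_lower := L.main_sum_lower
    bound := L.bound
    bound_nonneg := L.bound_nonneg
    bound_summable := L.bound_summable
    norm_term_le := fun N o ho => L.norm_term_le N o (fun h => ho (h ▸ L.main_mem)) }

/-- **LOCALISER WITH A MAIN SET, plan-3's (R4) fields, MAJORANT OFF THE SET**: termwise positivity on the set, the
lower bound on the distinguished term, and the majorant only off the set. -/
structure LocalizerSetOff (E : OrbitExpansion Orbit pairing term) where
  /-- the persistent orbits -/
  mainSet : Set Orbit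
  /-- the distinguished persistent orbit -/
  main : Orbit
  main_mem : main ∈ mainSet
  /-- the level of the depth-`N` localiser -/
  level : ℕ → Level
  /-- the depth-`N` localising translate, of level `level N` -/
  loc : ∀ N : ℕ, Tr (level N)
  /-- off the main set the localiser's terms tend to `0` -/
  tendsto_zero : ∀ o : Orbit, o ∉ mainSet → Tendsto (fun N => term (level N) (loc N) o) atTop (𝓝 0)
  /-- from some depth on, every term of the main set is a non-negative real -/
  main_pos : ∃ N₀ : ℕ, ∀ N, N₀ ≤ N → ∀ o ∈ mainSet,
    (term (level N) (loc N) o).im = 0 ∧ 0 ≤ (term (level N) (loc N) o).re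
  /-- the real part of the distinguished term is eventually bounded below -/
  main_lower : ∃ m : ℝ, 0 < m ∧ ∀ᶠ N in atTop, m ≤ (term (level N) (loc N) main).re
  /-- one summable majorant of the terms OFF the main set, for all depths -/
  bound : Orbit → ℝ
  bound_nonneg : ∀ o, 0 ≤ bound o
  bound_summable : Summable bound
  norm_term_le : ∀ (N : ℕ) (o : Orbit), o ∉ mainSet → ‖term (level N) (loc N) o‖ ≤ bound o

namespace LocalizerSetOff

variable {E : OrbitExpansion Orbit pairing term} (L : E.LocalizerSetOff)

/-- The summand over the main set is summable. -/
theorem summable_mainSummand (N : ℕ) :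
    Summable (fun o : Orbit => if o ∈ L.mainSet then term (L.level N) (L.loc N) o else 0) := by
  refine Summable.of_norm_bounded (E.summable_norm (L.level N) (L.loc N)) ?_
  intro o
  by_cases ho : o ∈ L.mainSet
  · simp [ho]
  · simp [ho]

/-- Termwise positivity on the set gives the sum clause. -/
theorem main_sum_lower : ∃ m : ℝ, 0 < m ∧ ∀ᶠ N in atTop,
    m ≤ (∑' o : Orbit, if o ∈ L.mainSet then term (L.level N) (L.loc N) o else 0).re := by
  obtain ⟨N₀, hpos⟩ := L.main_pos
  obtain ⟨m, hm, hev⟩ := L.main_lower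
  refine ⟨m, hm, ?_⟩
  filter_upwards [hev, eventually_ge_atTop N₀] with N hN hN₀
  set f : Orbit → ℂ := fun o => if o ∈ L.mainSet then term (L.level N) (L.loc N) o else 0 with hf
  have hsum : Summable f := L.summable_mainSummand N
  have hre : ∀ o, 0 ≤ (f o).re := by
    intro o
    by_cases ho : o ∈ L.mainSet
    · simp only [hf, ho, if_true]
      exact (hpos N hN₀ o ho).2
    · simp [hf, ho]
  have hmain : m ≤ (f L.main).re := by
    simp only [hf, L.main_mem, if_true]
    exact hN
  rw [Complex.re_tsum hsum]
  exact hmain.trans ((Complex.hasSum_re hsum.hasSum).summable.le_tsum _ (fun o _ => hre o))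

/-- A localiser with termwise positivity on the set is one in sum form. -/
def toLocalizerSumOff : E.LocalizerSumOff :=
  { mainSet := L.mainSet
    level := L.level
    loc := L.loc
    tendsto_zero := L.tendsto_zero
    main_sum_lower := L.main_sum_lower
    bound := L.bound
    bound_nonneg := L.bound_nonneg
    bound_summable := L.bound_summable
    norm_term_le := L.norm_term_le }

/-- **THE CONCLUSION OF THE ASSEMBLY ((R4), MAJORANT OFF THE SET).** -/
theorem P (L : E.LocalizerSetOff) : ∃ (K : Level) (γ : Tr K), pairing K γ ≠ 0 :=
  L.toLocalizerSumOff.P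

end LocalizerSetOff

/-- A localiser with the majorant off `main` is one with the majorant off the set. -/
def LocalizerSet.toOff {E : OrbitExpansion Orbit pairing term} (L : E.LocalizerSet) : E.LocalizerSetOff :=
  { mainSet := L.mainSet
    main := L.main
    main_mem := L.main_mem
    level := L.level
    loc := L.loc
    tendsto_zero := L.tendsto_zero
    main_pos := L.main_pos
    main_lower := L.main_lower
    bound := L.bound
    bound_nonneg := L.bound_nonneg
    bound_summable := L.bound_summable
    norm_term_le := fun N o ho => L.norm_term_le N o (fun h => ho (h ▸ L.main_mem)) }

end OrbitExpansion

end Assembly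

end Summit.Ventures.HodgeRepro.Tier4.Line3

end
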